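import Literature.IUT.HodgeTheaters.TemperedCoverings
import Literature.IUT.HodgeTheaters.TemperedCoveringsDensity
import HarnessLib

/-!
# [IUTchI] Corollary 2.3 (ii), (v) AS TYPED, modulo the tempered-vs-profinite interface facts

Mochizuki, *Inter-universal Teichmüller theory I*, kurims manuscript (May 2020), §2, Corollary 2.3 (ii)
p. 47, (v) p. 48, proof pp. 48–50 ([IUTchI] Cor 2.3 pp.47-50) [claim: Mochizuki2012, status: disputed].
Proof-only companion of `TemperedCoverings.lean` (seat abc-iut-L5-t1): the typed predicates
`StableCurveTemperedData.Cor23ii` ("the closure of `Δ^tp_{X,ℍ}` in `Δ̂_X` is `Δ̂_{X,ℍ}`") and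
`StableCurveTemperedData.Cor23v` ("`Δ̂_{X,ℍ} ∩ Δ^tp_X = Δ^tp_{X,ℍ}`") are DERIVED from hypotheses on the
interface data that say exactly what the printed proof takes from "the definitions of the various
tempered fundamental groups involved" (pp. 48, 49) — stated inline, never asserted:

* for (v): the 𝔾-level statement `Π̂_ℍ ∩ Π^tp_𝔾 = Π^tp_ℍ` inside `Π̂_𝔾` (the "`F̂ ∩ G = F`" of p. 49,
  kernel-proved for free groups / retracts in `TemperedCoveringsDensity.lean`) — `cor23v_of_graph`;
* for (ii): `Π̂_ℍ` is the closure of `Π^tp_ℍ` in `Π̂_𝔾`, the kernel of `Δ̂_X ↠ Π̂_𝔾` is the closure of its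
  intersection with `Δ^tp_X` (the "elementary observation" of p. 48, kernel-proved for surjections with
  a section in `TemperedCoveringsDensity.lean`), `Δ̂_X ↠ Π̂_𝔾` is continuous, `Δ̂_X` is closed in `Π̂_X`
  (so compact) and `Π̂_𝔾` is Hausdorff — `cor23ii_of_density`, through the abstract
  `ProfiniteCompletion.closure_inter_preimage_eq_preimage_closure`.

The unconditional compatibility `ρ̂(ι_Δ d) = ι(ρ^tp d)` of the interface (`ρ_comp`) and the
injectivity of `ι : Π^tp_𝔾 ↪ Π̂_𝔾` do the rest.  No new definitions; no side taken on [IUTchIII]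
Cor. 3.12; the hypotheses are the L3 merge debt (tempered fundamental groups, [SemiAnbd] §3), not facts
proved here.
-/

namespace Literature.IUT.HodgeTheaters

namespace StableCurveTemperedData

open Topology

universe u

variable (D : StableCurveTemperedData.{u})

/-- The compatibility of the interface in the form used below: `ρ̂_X(ι_Δ(d)) = ι(ρ^tp_X(d))` for
`d ∈ Δ^tp_X` ("compatibility `Π^tp_𝔾 ↪ Π̂_𝔾` versus `Δ^tp_X ↪ Δ̂_X`", p. 47).
([IUTchI] Cor 2.3 p.47) [claim: Mochizuki2012, status: disputed] -/
theorem ρHat_ιΔ (d : D.DeltaTp) : D.ρHat (D.ιΔ d) = D.graph.ι (D.ρTp d) :=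
  (D.ρ_comp d).symm

/-- `ι_Δ(Δ^tp_{X,ℍ}) = ι_Δ(Δ^tp_X) ∩ ρ̂⁻¹(ι(Π^tp_ℍ))` inside `Δ̂_X` (injectivity of `ι`).
([IUTchI] Cor 2.3(ii) p.47) [claim: Mochizuki2012, status: disputed] -/
theorem coe_map_deltaTpH :
    ((D.deltaTpH.map D.ιΔ : Subgroup D.DeltaHat) : Set D.DeltaHat) =
      (D.ιΔ.range : Set D.DeltaHat) ∩ D.ρHat ⁻¹' (D.graph.TpH.map D.graph.ι : Set D.graph.Hat) := by
  ext x
  constructor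
  · rintro ⟨d, hd, rfl⟩
    refine ⟨⟨d, rfl⟩, ?_⟩
    rw [Set.mem_preimage, ρHat_ιΔ]
    exact ⟨D.ρTp d, hd, rfl⟩
  · rintro ⟨⟨d, rfl⟩, hx⟩
    rw [Set.mem_preimage, ρHat_ιΔ] at hx
    obtain ⟨t, ht, htd⟩ := hx
    refine ⟨d, ?_, rfl⟩
    show D.ρTp d ∈ D.graph.TpH
    rw [← D.graph.ι_injective htd]
    exact ht

/-- `Π^tp_ℍ ⊆ ρ̂(ι_Δ(Δ^tp_X))`: every element of `Π^tp_ℍ ⊆ Π^tp_𝔾` is the image of an element of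
`Δ^tp_X` (surjectivity of `Δ^tp_X ↠ Π^tp_𝔾`, p. 47). ([IUTchI] Cor 2.3 p.47) [claim: Mochizuki2012, status: disputed] -/
theorem map_tpH_subset_image :
    ((D.graph.TpH.map D.graph.ι : Subgroup D.graph.Hat) : Set D.graph.Hat) ⊆
      D.ρHat '' (D.ιΔ.range : Set D.DeltaHat) := by
  rintro _ ⟨t, -, rfl⟩
  obtain ⟨d, rfl⟩ := D.ρTp_surjective t
  exact ⟨D.ιΔ d, ⟨d, rfl⟩, D.ρHat_ιΔ d⟩

/-- **Corollary 2.3 (v) from the 𝔾-level statement.**  If `Π̂_ℍ ∩ Π^tp_𝔾 = Π^tp_ℍ` inside `Π̂_𝔾`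
[the "`F̂ ∩ G = F`" of the printed proof, p. 49], then `Δ̂_{X,ℍ} ∩ Δ^tp_X = Δ^tp_{X,ℍ}` — the typed
`Cor23v` holds for `D`. ([IUTchI] Cor 2.3(v) p.48) [claim: Mochizuki2012, status: disputed] -/
theorem cor23v_of_graph
    (hv : (D.graph.HatH : Set D.graph.Hat) ∩ Set.range D.graph.ι = D.graph.ι '' D.graph.TpH) :
    D.Cor23v := by
  refine ⟨le_antisymm ?_ ?_⟩
  · rintro x ⟨hxH, ⟨d, rfl⟩⟩
    have h1 : D.graph.ι (D.ρTp d) ∈ (D.graph.HatH : Set D.graph.Hat) ∩ Set.range D.graph.ι :=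
      ⟨by rw [← ρHat_ιΔ]; exact hxH, ⟨D.ρTp d, rfl⟩⟩
    rw [hv] at h1
    obtain ⟨t, ht, htd⟩ := h1
    refine ⟨d, ?_, rfl⟩
    show D.ρTp d ∈ D.graph.TpH
    rw [← D.graph.ι_injective htd]
    exact ht
  · rintro _ ⟨d, hd, rfl⟩
    refine ⟨?_, ⟨d, rfl⟩⟩
    show D.ρHat (D.ιΔ d) ∈ D.graph.HatH
    rw [ρHat_ιΔ]
    exact D.graph.tpH_le ⟨D.ρTp d, hd, rfl⟩

/-- **Corollary 2.3 (ii) from the tempered-vs-profinite interface facts.**  Suppose `Π̂_𝔾` is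
Hausdorff, `Δ̂_X` is closed in `Π̂_X` [as the kernel of a continuous `Π̂_X ↠ G_k`], `ρ̂ : Δ̂_X ↠ Π̂_𝔾` is
continuous, `Π̂_ℍ` is the closure of `Π^tp_ℍ` in `Π̂_𝔾`, and the kernel of `ρ̂` is the closure of its
intersection with `Δ^tp_X` [the "elementary observation" of p. 48].  Then the closure of `Δ^tp_{X,ℍ}`
in `Δ̂_X` is `Δ̂_{X,ℍ}` — the typed `Cor23ii` holds for `D`. ([IUTchI] Cor 2.3(ii) p.47) [claim: Mochizuki2012, status: disputed] -/
theorem cor23ii_of_density [T2Space D.graph.Hat] (hΔ : IsClosed (D.DeltaHat : Set D.PiHat))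
    (hρ : Continuous D.ρHat)
    (hH : (D.graph.HatH : Set D.graph.Hat) = closure (D.graph.ι '' D.graph.TpH))
    (hker : (D.ρHat.ker : Set D.DeltaHat) ⊆
      closure ((D.ιΔ.range : Set D.DeltaHat) ∩ (D.ρHat.ker : Set D.DeltaHat))) :
    D.Cor23ii := by
  haveI : CompactSpace D.DeltaHat := isCompact_iff_compactSpace.mp hΔ.isCompact
  have key := ProfiniteCompletion.closure_inter_preimage_eq_preimage_closure D.ρHat hρ D.ιΔ.range
    hker (D.graph.TpH.map D.graph.ι) D.map_tpH_subset_image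
  refine ⟨SetLike.coe_injective ?_⟩
  rw [Subgroup.topologicalClosure_coe, coe_map_deltaTpH, key, Subgroup.coe_map, ← hH]
  rfl

end StableCurveTemperedData

end Literature.IUT.HodgeTheaters
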